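import Mathlib
import Summits.HodgeConjecture.FermatCycles.HodgeFermatChiThreeA

/-!
# LEMMA O (unit multiples) of `tables/DPRIME-THEOREM.md` §1 — every level (`HodgeFermat/LemmaO.lean`)

Tree copy (whole module) of the module `HodgeFermat/LemmaO.lean` of the sibling cell's standalone package
`run/shared/lean/pub/pub-hodgefermat/lean/HodgeFermat/` (214 lines, sha256 `67f1b455675814d9…`), source lines 29–214 (all: unit lifting, LEMMA O `lemmaO_mem`/`lemmaO_surj`, the counts `lemmaO_g`, `lemmaO_n_sub_g`, `lemmaO_half_sub`, `lemmaO_half_add`).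
Filed by cell `pub-hfermat`, seat prover-1 gen-3, on the COORDINATOR KEEPER RULING of 2026-08-25 (gem sweep H1: take the
off-gate kernel theorem `thmFstar` through the gate) — here THEOREM F* of `tables/DPRIME-THEOREM.md` §9 IN FULL, i.e.
PROPOSITION D′(3N) and the descent (`HodgeFermat/PropDPrimeNFinal.lean`, GATE HF-G34), the last off-gate form of THEOREM F*
(its first two forms, `DecodingFinal.thmFstar` = F* at the prime levels and `ThmFstarNFinal.thmFstar` = F*(3N), landed on
2026-08-25 as `HodgeFermatThmFstar.lean` / `HodgeFermatThmFstarN.lean`, seats prover-1 gen-0 / gen-2); this file is one link of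
the import closure of `PropDPrimeNFinal.propDprime` (the sibling's KR-free chain: THEOREM L, COROLLARY M, THEOREM D6,
THEOREM U⁺, THEOREM KR6, THEOREM Z3U) on top of those landed chains.  The source module is the sibling's hub-checked module of
record (pub-hodgefermat `CERT.md` l.873, GATE HF-G21d; module of the THEOREM L chain); its declarations are copied VERBATIM.
Deviations from the source module, exhaustively: the `import` lines (tree modules `Summits.HodgeConjecture.FermatCycles.
HodgeFermat*` instead of `HodgeFermat.*`); this module docstring; DEDUP (pre-empting the gate's `dedup.landed`): the source's `lemma coprime_mod_iff` (l.48–52, with its section header) restates the landed `HodgeFermat.KRFree.ChiThree.coprime_mod_iff` (`HodgeFermatChiThreeA.lean`) VERBATIM up to the name of a bound variable and is therefore DELETED, its two uses (source l.61, 70) resolving to the landed lemma through the added line `open HodgeFermat.KRFree.ChiThree (coprime_mod_iff)` (extra import); one-line docstrings added (gate lint) to `core_mem`, `core_surj`.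
Every other line — in particular every declaration's statement and proof — is byte-identical to the source.
HONEST FRAMING: explicit algebraic cycles for specific Hodge classes on Fermat/Delsarte varieties; residual open instances
listed; no claim on general Hodge.  (This file is arithmetic of CM types / finite combinatorics / analytic number theory
of the sibling's KR-free programme; it claims nothing about cycles.)

The source module's docstring (LemmaO.lean l.3–27), verbatim:

## LEMMA O (unit multiples) of `tables/DPRIME-THEOREM.md` §1 — kernel-checked for EVERY level
## (build hodge-fermat, generation 21, second addendum)

LEMMA O (DPRIME §1; used in the rows (Z3,Z1), (Z1,Z1), (U,Z1) of THEOREM L, §3, and thence in THEOREM D6 of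
`tables/KR-FREE.md`).  Let `n ≥ 1`, `z ∈ ℤ/n`, `g = gcd(z, n)`, `n′ = n/g`.  Then
  `{⟨uz⟩_n : u ∈ (ℤ/n)ˣ} = {g·s : 0 ≤ s < n′, gcd(s, n′) = 1}`;
in particular (for `z ≢ 0`, i.e. `n′ ≥ 2`) the values `g` and `n − g` occur, and for odd `n` also `(n − g)/2 = g(n′−1)/2` and
`(n + g)/2 = g(n′+1)/2`.

What this file proves (namespace `HodgeFermat.KRFree.LemmaO`), for all `n ≥ 1` and all `z` (the hypothesis "n odd" of DPRIME is
needed only for the two half-values; `z ≡ 0` is allowed where it makes sense, with `n′ = 1`, `s = 0`):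
* `lemmaO_mem`  (⊆): `Nat.Coprime u n → ∃ s, s < n / gcd z n ∧ Nat.Coprime s (n / gcd z n) ∧ u * z % n = gcd z n * s`;
* `lemmaO_surj` (⊇): `s < n / gcd z n → Nat.Coprime s (n / gcd z n) → ∃ u, Nat.Coprime u n ∧ u * z % n = gcd z n * s`;
* the four named values: `lemmaO_g` (`⟨uz⟩_n = g`), `lemmaO_n_sub_g` (`= n − g`), `lemmaO_half_sub` (`2⟨uz⟩_n = n − g`, n odd),
  `lemmaO_half_add` (`2⟨uz⟩_n = n + g`, n odd), each for some unit `u`, under `¬ n ∣ z`.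
The one non-trivial input is the surjectivity of `(ℤ/n)ˣ → (ℤ/n′)ˣ` for `n′ ∣ n`, taken from Mathlib (`ZMod.unitsMap_surjective`)
and restated over ℕ as `unit_lift`; everything else is elementary arithmetic of residues.

Kernel instance (`decide`): `n = 15`, `z = 6` (`g = 3`, `n′ = 5`): the image of the units is exactly `{3, 6, 9, 12}`, and the four named
values `3, 12, 6, 9` are attained at `u = 8, 2, 1, 4`.

`import Mathlib` only; `set_option autoImplicit false`; no `sorry`, no `native_decide`; axioms of every theorem =
[propext, Classical.choice, Quot.sound]; hub `lean check` rc 0, 0 errors, 0 warnings.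
-/

set_option autoImplicit false

namespace HodgeFermat.KRFree.LemmaO

open HodgeFermat.KRFree.ChiThree (coprime_mod_iff)

/-! ## Unit lifting along `ℤ/n → ℤ/n′` (Mathlib's `ZMod.unitsMap_surjective`, over ℕ) -/

/-- every unit `w` of `ℤ/n′` lifts to a unit `u` of `ℤ/n` when `n′ ∣ n` -/
lemma unit_lift (n n' w : ℕ) (hn : 0 < n) (hd : n' ∣ n) (hw : Nat.Coprime w n') :
    ∃ u, Nat.Coprime u n ∧ u ≡ w [MOD n'] := by
  haveI : NeZero n := ⟨hn.ne'⟩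
  obtain ⟨U, hU⟩ := ZMod.unitsMap_surjective hd (ZMod.unitOfCoprime w hw)
  refine ⟨(U : ZMod n).val, ZMod.val_coe_unit_coprime U, ?_⟩
  have h1 : (((U : ZMod n).val : ℕ) : ZMod n') = (w : ZMod n') := by
    have h2 := congrArg (fun x : (ZMod n')ˣ => (x : ZMod n')) hU
    simp only [ZMod.unitsMap_def, Units.coe_map, ZMod.coe_unitOfCoprime, MonoidHom.coe_coe,
      ZMod.castHom_apply, ZMod.cast_eq_val] at h2
    exact h2
  exact (ZMod.natCast_eq_natCast_iff' _ _ _).mp h1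

/-! ## LEMMA O in coordinates `n = g·n′`, `z = g·z′`, `gcd(z′, n′) = 1` -/

/-- LEMMA O, membership half, in coordinates `n = g·n′`, `z = g·z′`: `u·z mod n = g·s` with `s` a unit mod `n′` -/
lemma core_mem (g n' z' u : ℕ) (hn' : 0 < n') (hcop : Nat.Coprime z' n')
    (hu : Nat.Coprime u (g * n')) :
    ∃ s, s < n' ∧ Nat.Coprime s n' ∧ u * (g * z') % (g * n') = g * s := by
  refine ⟨u * z' % n', Nat.mod_lt _ hn', ?_, ?_⟩
  · have hu' : Nat.Coprime u n' := Nat.Coprime.coprime_dvd_right ⟨g, by ring⟩ hu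
    exact (coprime_mod_iff _ _).mpr (Nat.Coprime.mul_left hu' hcop)
  · rw [show u * (g * z') = g * (u * z') by ring, Nat.mul_mod_mul_left]

/-- LEMMA O, surjectivity half, in coordinates: every `g·s`, `s` a unit mod `n′`, is `u·z mod n` for a unit `u` mod `n` -/
lemma core_surj (g n' z' s : ℕ) (hg : 0 < g) (hn' : 0 < n') (hcop : Nat.Coprime z' n') (hs : s < n')
    (hsc : Nat.Coprime s n') :
    ∃ u, Nat.Coprime u (g * n') ∧ u * (g * z') % (g * n') = g * s := by
  obtain ⟨m, _, hm⟩ := Nat.exists_mul_mod_eq_of_coprime s hcop hn'.ne'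
  rw [Nat.mod_eq_of_lt hs] at hm
  have hmc : Nat.Coprime m n' := by
    have h1 : Nat.Coprime (z' * m) n' := (coprime_mod_iff _ _).mp (by rw [hm]; exact hsc)
    exact Nat.Coprime.coprime_mul_left h1
  obtain ⟨u, hu, huw⟩ := unit_lift (g * n') n' m (Nat.mul_pos hg hn') ⟨g, by ring⟩ hmc
  refine ⟨u, hu, ?_⟩
  rw [show u * (g * z') = g * (u * z') by ring, Nat.mul_mod_mul_left]
  have h2 : u * z' % n' = m * z' % n' := huw.mul_right z'
  rw [h2, mul_comm m z', hm]

/-! ## LEMMA O -/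

/-- decomposition `n = g·n′`, `z = g·z′` with `g = gcd(z, n)`, `gcd(z′, n′) = 1`, `n / g = n′` -/
lemma decompose (n z : ℕ) (hn : 0 < n) :
    ∃ n' z', 0 < n' ∧ n = Nat.gcd z n * n' ∧ z = Nat.gcd z n * z' ∧ Nat.Coprime z' n'
      ∧ n / Nat.gcd z n = n' := by
  have hg0 : 0 < Nat.gcd z n := Nat.gcd_pos_of_pos_right _ hn
  obtain ⟨n', hn'⟩ := Nat.gcd_dvd_right z n
  obtain ⟨z', hz'⟩ := Nat.gcd_dvd_left z n
  have hn'0 : 0 < n' := by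
    rcases Nat.eq_zero_or_pos n' with h | h
    · rw [h, Nat.mul_zero] at hn'; omega
    · exact h
  have hdn : n / Nat.gcd z n = n' := Nat.div_eq_of_eq_mul_right hg0 hn'
  have hdz : z / Nat.gcd z n = z' := Nat.div_eq_of_eq_mul_right hg0 hz'
  have hcop : Nat.Coprime z' n' := by
    have h := Nat.coprime_div_gcd_div_gcd (m := z) (n := n) hg0
    rwa [hdn, hdz] at h
  exact ⟨n', z', hn'0, hn', hz', hcop, hdn⟩

/-- **LEMMA O (⊆).**  For a unit `u` of `ℤ/n`: `⟨uz⟩_n = g·s` with `0 ≤ s < n′ = n/g` and `gcd(s, n′) = 1` (`g = gcd(z, n)`). -/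
theorem lemmaO_mem (n z u : ℕ) (hn : 0 < n) (hu : Nat.Coprime u n) :
    ∃ s, s < n / Nat.gcd z n ∧ Nat.Coprime s (n / Nat.gcd z n) ∧ u * z % n = Nat.gcd z n * s := by
  obtain ⟨n', z', hn'0, hn', hz', hcop, hdn⟩ := decompose n z hn
  rw [hdn]
  have hu' : Nat.Coprime u (Nat.gcd z n * n') := by rw [← hn']; exact hu
  obtain ⟨s, hs, hsc, he⟩ := core_mem (Nat.gcd z n) n' z' u hn'0 hcop hu'
  refine ⟨s, hs, hsc, ?_⟩
  rw [← hn', ← hz'] at he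
  exact he

/-- **LEMMA O (⊇).**  Every `g·s` with `0 ≤ s < n′`, `gcd(s, n′) = 1` is `⟨uz⟩_n` for some unit `u` of `ℤ/n`. -/
theorem lemmaO_surj (n z s : ℕ) (hn : 0 < n) (hs : s < n / Nat.gcd z n)
    (hsc : Nat.Coprime s (n / Nat.gcd z n)) :
    ∃ u, Nat.Coprime u n ∧ u * z % n = Nat.gcd z n * s := by
  obtain ⟨n', z', hn'0, hn', hz', hcop, hdn⟩ := decompose n z hn
  rw [hdn] at hs hsc
  have hg0 : 0 < Nat.gcd z n := Nat.gcd_pos_of_pos_right _ hn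
  obtain ⟨u, hu, he⟩ := core_surj (Nat.gcd z n) n' z' s hg0 hn'0 hcop hs hsc
  refine ⟨u, ?_, ?_⟩
  · rw [hn']; exact hu
  · rw [← hn', ← hz'] at he
    exact he

/-! ## The named values -/

/-- `z ≢ 0 (mod n)` means `n′ ≥ 2` -/
lemma two_le_quot (n z : ℕ) (hn : 0 < n) (hz : ¬ n ∣ z) : 2 ≤ n / Nat.gcd z n := by
  obtain ⟨n', z', hn'0, hn', hz', _, hdn⟩ := decompose n z hn
  rw [hdn]
  by_contra h
  have h1 : n' = 1 := by omega
  rw [h1, Nat.mul_one] at hn'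
  rw [← hn'] at hz'
  exact hz ⟨z', hz'⟩

/-- the value `g`: some unit `u` has `⟨uz⟩_n = gcd(z, n)` -/
theorem lemmaO_g (n z : ℕ) (hn : 0 < n) (hz : ¬ n ∣ z) :
    ∃ u, Nat.Coprime u n ∧ u * z % n = Nat.gcd z n := by
  have h2 := two_le_quot n z hn hz
  obtain ⟨u, hu, he⟩ := lemmaO_surj n z 1 hn (by omega) (Nat.coprime_one_left _)
  exact ⟨u, hu, by rw [he, Nat.mul_one]⟩

/-- the value `n − g`: some unit `u` has `⟨uz⟩_n = n − gcd(z, n)` -/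
theorem lemmaO_n_sub_g (n z : ℕ) (hn : 0 < n) (hz : ¬ n ∣ z) :
    ∃ u, Nat.Coprime u n ∧ u * z % n = n - Nat.gcd z n := by
  obtain ⟨n', z', hn'0, hn', _, _, hdn⟩ := decompose n z hn
  have h2 := two_le_quot n z hn hz
  rw [hdn] at h2
  have hsc : Nat.Coprime (n' - 1) n' := by
    have h : Nat.Coprime (n' - 1) (1 + (n' - 1)) :=
      Nat.coprime_add_self_right.mpr (Nat.coprime_one_right _)
    rwa [show 1 + (n' - 1) = n' by omega] at h
  obtain ⟨u, hu, he⟩ := lemmaO_surj n z (n' - 1) hn (by rw [hdn]; omega) (by rw [hdn]; exact hsc)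
  refine ⟨u, hu, ?_⟩
  rw [he, Nat.mul_sub, Nat.mul_one, ← hn']

/-- `n` odd ⇒ `n′` odd -/
lemma quot_odd (n z : ℕ) (hn : 0 < n) (hodd : Odd n) : Odd (n / Nat.gcd z n) := by
  obtain ⟨n', z', _, hn', _, _, hdn⟩ := decompose n z hn
  rw [hdn]
  rw [hn'] at hodd
  exact (Nat.odd_mul.mp hodd).2

/-- the value `(n − g)/2 = g(n′−1)/2` (n odd): some unit `u` has `2⟨uz⟩_n = n − gcd(z, n)` -/
theorem lemmaO_half_sub (n z : ℕ) (hn : 0 < n) (hodd : Odd n) (hz : ¬ n ∣ z) :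
    ∃ u, Nat.Coprime u n ∧ 2 * (u * z % n) = n - Nat.gcd z n := by
  obtain ⟨n', z', hn'0, hn', _, _, hdn⟩ := decompose n z hn
  have h2 := two_le_quot n z hn hz
  have ho := quot_odd n z hn hodd
  rw [hdn] at h2 ho
  obtain ⟨k, hk⟩ := ho
  -- s = k = (n′ − 1)/2, 2k = n′ − 1
  have hsc : Nat.Coprime k n' := by
    have h : Nat.Coprime (n' - 1) n' := by
      have h' : Nat.Coprime (n' - 1) (1 + (n' - 1)) :=
        Nat.coprime_add_self_right.mpr (Nat.coprime_one_right _)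
      rwa [show 1 + (n' - 1) = n' by omega] at h'
    rw [show n' - 1 = 2 * k by omega] at h
    exact Nat.Coprime.coprime_mul_left h
  obtain ⟨u, hu, he⟩ := lemmaO_surj n z k hn (by rw [hdn]; omega) (by rw [hdn]; exact hsc)
  refine ⟨u, hu, ?_⟩
  rw [he]
  calc 2 * (Nat.gcd z n * k) = Nat.gcd z n * n' - Nat.gcd z n := by
        rw [hk, Nat.mul_add, Nat.mul_one, Nat.add_sub_cancel]; ring
    _ = n - Nat.gcd z n := by rw [← hn']

/-- the value `(n + g)/2 = g(n′+1)/2` (n odd): some unit `u` has `2⟨uz⟩_n = n + gcd(z, n)` -/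
theorem lemmaO_half_add (n z : ℕ) (hn : 0 < n) (hodd : Odd n) (hz : ¬ n ∣ z) :
    ∃ u, Nat.Coprime u n ∧ 2 * (u * z % n) = n + Nat.gcd z n := by
  obtain ⟨n', z', hn'0, hn', _, _, hdn⟩ := decompose n z hn
  have h2 := two_le_quot n z hn hz
  have ho := quot_odd n z hn hodd
  rw [hdn] at h2 ho
  obtain ⟨k, hk⟩ := ho
  -- s = k + 1 = (n′ + 1)/2, 2(k+1) = n′ + 1
  have hsc : Nat.Coprime (k + 1) n' := by
    have h : Nat.Coprime (n' + 1) n' := by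
      have h' : Nat.Coprime (1 + n') n' := Nat.coprime_add_self_left.mpr (Nat.coprime_one_left _)
      rwa [Nat.add_comm] at h'
    rw [show n' + 1 = 2 * (k + 1) by omega] at h
    exact Nat.Coprime.coprime_mul_left h
  obtain ⟨u, hu, he⟩ := lemmaO_surj n z (k + 1) hn (by rw [hdn]; omega) (by rw [hdn]; exact hsc)
  refine ⟨u, hu, ?_⟩
  rw [he]
  calc 2 * (Nat.gcd z n * (k + 1)) = Nat.gcd z n * n' + Nat.gcd z n := by rw [hk]; ring
    _ = n + Nat.gcd z n := by rw [← hn']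

/-! ## Kernel instance: `n = 15`, `z = 6` (`g = 3`, `n′ = 5`) -/

example : ((Finset.range 15).filter (fun u => Nat.Coprime u 15)).image (fun u => u * 6 % 15)
    = {3, 6, 9, 12} := by decide

example : Nat.gcd 6 15 = 3 ∧ 8 * 6 % 15 = 3 ∧ 2 * 6 % 15 = 15 - 3 ∧ 2 * (1 * 6 % 15) = 15 - 3
    ∧ 2 * (4 * 6 % 15) = 15 + 3 := by decide

end HodgeFermat.KRFree.LemmaO
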